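import Summits.HubbardSuperconductivity.HubbardSuperconductivity.Theorems.WidthHaldaneDirichletBlockSums
import Mathlib.Analysis.SpecialFunctions.Trigonometric.Inverse

/-!
# Shifted channel sums of the twisted free tube in closed form

Support file for the tube cruxes stated over `WidthHaldaneDefs` (routes `WidthHaldane`,
`SeamInduction`; items stmt-HubbardSuperconductivity-16311/16312/18509/18510), all PROVED, no
definitions, no named facts. At `U = 0` the twisted sector energy of the tube `ℤ/L × ℤ/M` is a
Fermi sum of the twisted band `ε^θ(a,b) = -2cos((2πa-θ)/L) - 2cos(2πb/M)`
(`tubeEnergy_free_twisted_eq`), and its bathtub dual `Σ_k (μ - ε^θ_k)₊` splits over the transverse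
channels `b` into the one-dimensional SHIFTED CHANNEL SUMS
`S_L(c,θ) = Σ_{a ∈ ℤ/L} (c + 2cos((2πa-θ)/L))₊`, `c = μ + 2cos(2πb/M)`. This file evaluates them
exactly (the free multichannel-ring bookkeeping of Cheung–Gefen–Riedel–Shih):

* `two_sin_half_mul_sum_cos_arith` — the telescoped cosine sum over an arithmetic progression;
* `sum_zmod_eq_sum_range_of_periodic` — a sum over `ℤ/L` of an `L`-periodic `g : ℤ → ℝ` is the
  sum over ANY window of `L` consecutive integers;
* `cos_le_cos_sub_of_window`, `cos_sub_lt_cos_of_window` — the sign pattern of `cos(ψ-x) - cos x`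
  on a period;
* **`shiftedChannel_closedForms`** — for `-2 < c < 2`, `x = arccos(-c/2)`, `t = Lx/(2π)`,
  `s = θ/(2π)`: `#{a : c + 2cos((2πa-θ)/L) ≥ 0} = ⌊t+s⌋ + ⌊t-s⌋ + 1` and
  `S_L(c,θ) = c(⌊t+s⌋ + ⌊t-s⌋ + 1) + [sin(x + (1-2{t+s})π/L) + sin(x + (1-2{t-s})π/L)]/sin(π/L)`;
* `shiftedChannelCount_ge`, `shiftedChannelCount_le` — `Lx/π - 1 ≤ # ≤ Lx/π + 1` (the lower bound
  for EVERY `c`, Mathlib's clipped `arccos`);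
* `sum_zmod_cos_shift_eq_zero` — a full-period cosine sum vanishes for every phase.

The second-order expansion in `1/L` (the `B₂` sawtooth) is `WidthHaldaneShiftedChannelExpansion`.
[cite: CheungGefenRiedelShih1988] [cite: ScalapinoWhiteZhang1993, §II]
-/

noncomputable section

namespace Summit.HubbardSuperconductivity.HubbardSuperconductivity.Theorems.WidthHaldane

set_option linter.dupNamespace false -- summit = problem name (single-conjunct summit), D-0017

open scoped BigOperators Classical
open Finset

section Telescoping

/-- `2 sin(h/2) cos φ = sin(φ + h/2) - sin(φ - h/2)`. [folklore] -/
theorem two_sin_half_mul_cos_eq (φ h : ℝ) :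
    2 * Real.sin (h / 2) * Real.cos φ = Real.sin (φ + h / 2) - Real.sin (φ - h / 2) := by
  rw [Real.sin_add, Real.sin_sub]
  ring

/-- **Telescoped cosine sum over an arithmetic progression**:
`2 sin(h/2) Σ_{i<n} cos(φ₀ + i h) = sin(φ₀ + (n - ½)h) - sin(φ₀ - h/2)`. [folklore] -/
theorem two_sin_half_mul_sum_cos_arith (φ₀ h : ℝ) (n : ℕ) :
    2 * Real.sin (h / 2) * ∑ i ∈ Finset.range n, Real.cos (φ₀ + i * h) =
      Real.sin (φ₀ + ((n : ℝ) - 1 / 2) * h) - Real.sin (φ₀ - h / 2) := by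
  rw [Finset.mul_sum]
  have hstep : ∀ i : ℕ, 2 * Real.sin (h / 2) * Real.cos (φ₀ + i * h) =
      Real.sin (φ₀ + (((i + 1 : ℕ) : ℝ) - 1 / 2) * h) - Real.sin (φ₀ + ((i : ℝ) - 1 / 2) * h) := by
    intro i
    rw [two_sin_half_mul_cos_eq]
    push_cast
    ring_nf
  simp_rw [hstep]
  rw [Finset.sum_range_sub (fun i : ℕ => Real.sin (φ₀ + ((i : ℝ) - 1 / 2) * h))]
  push_cast
  ring_nf

end Telescoping

section Reindex

variable {L : ℕ} [NeZero L]

/-- An `L`-periodic function on `ℤ` takes the same value at `z` and at the representative of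
`z mod L`. [folklore] -/
theorem periodic_apply_val_intCast {g : ℤ → ℝ} (hg : Function.Periodic g L) (z : ℤ) :
    g (((z : ZMod L).val : ℕ) : ℤ) = g z := by
  have h : (((z : ZMod L).val : ℕ) : ℤ) = z % (L : ℤ) := ZMod.val_intCast z
  rw [h, Int.emod_def]
  have := hg.sub_int_mul_eq (z / (L : ℤ)) (x := z)
  rw [mul_comm] at this
  exact this

/-- **Periodic reindexing of a sum over `ℤ/L`**: for an `L`-periodic `g : ℤ → ℝ` and any window
start `a₀`, `Σ_{a ∈ ℤ/L} g(val a) = Σ_{i<L} g(a₀ + i)`. [folklore] -/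
theorem sum_zmod_eq_sum_range_of_periodic {g : ℤ → ℝ} (hg : Function.Periodic g L) (a₀ : ℤ) :
    ∑ a : ZMod L, g (a.val : ℤ) = ∑ i ∈ Finset.range L, g (a₀ + i) := by
  have hinj : Set.InjOn (fun i : ℕ => ((a₀ + i : ℤ) : ZMod L)) (Finset.range L : Set ℕ) := by
    intro i hi j hj hij
    simp only [Finset.coe_range, Set.mem_Iio] at hi hj
    have h1 : ((i : ℤ) : ZMod L) = ((j : ℤ) : ZMod L) := by
      have := hij
      simp only [Int.cast_add] at this
      exact add_left_cancel this
    have h2 : (i : ZMod L) = (j : ZMod L) := by exact_mod_cast h1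
    have h3 := (ZMod.natCast_eq_natCast_iff' i j L).1 h2
    rwa [Nat.mod_eq_of_lt hi, Nat.mod_eq_of_lt hj] at h3
  have himage : (Finset.range L).image (fun i : ℕ => ((a₀ + i : ℤ) : ZMod L)) = Finset.univ := by
    apply Finset.eq_univ_of_card
    rw [Finset.card_image_of_injOn hinj, Finset.card_range, ZMod.card]
  rw [← himage, Finset.sum_image hinj]
  refine Finset.sum_congr rfl fun i _ => ?_
  exact periodic_apply_val_intCast hg _

end Reindex

section Window

/-- Inside the window: `cos x ≤ cos(ψ - x)` for `0 ≤ ψ ≤ 2x`, `x ≤ π`. [folklore] -/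
theorem cos_le_cos_sub_of_window {x ψ : ℝ} (hxπ : x ≤ Real.pi) (hψ0 : 0 ≤ ψ)
    (hψ : ψ ≤ 2 * x) : Real.cos x ≤ Real.cos (ψ - x) := by
  rw [← Real.cos_abs (ψ - x)]
  refine Real.cos_le_cos_of_nonneg_of_le_pi (abs_nonneg _) hxπ ?_
  rw [abs_le]; constructor <;> linarith

/-- Outside the window: `cos(ψ - x) < cos x` for `2x < ψ < 2π`, `0 ≤ x`. [folklore] -/
theorem cos_sub_lt_cos_of_window {x ψ : ℝ} (hx0 : 0 ≤ x) (hψ : 2 * x < ψ)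
    (hψ2 : ψ < 2 * Real.pi) : Real.cos (ψ - x) < Real.cos x := by
  by_cases h : ψ - x ≤ Real.pi
  · exact Real.cos_lt_cos_of_nonneg_of_le_pi hx0 h (by linarith)
  · push Not at h
    rw [show Real.cos (ψ - x) = Real.cos (2 * Real.pi - (ψ - x)) by rw [Real.cos_two_pi_sub]]
    exact Real.cos_lt_cos_of_nonneg_of_le_pi hx0 (by linarith) (by linarith)

end Window

section Channel

variable {L : ℕ} [NeZero L]

/-- **The shifted channel in closed form.** For `L ≥ 2`, `-2 < c < 2` and any flux `θ`, with
`x = arccos(-c/2) ∈ (0, π)`, `t = Lx/(2π)`, `s = θ/(2π)`: the number of `a ∈ ℤ/L` with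
`c + 2cos((2πa - θ)/L) ≥ 0` is `⌊t+s⌋ + ⌊t-s⌋ + 1`, and
`Σ_a (c + 2cos((2πa - θ)/L))₊ = c(⌊t+s⌋ + ⌊t-s⌋ + 1) + [sin(x + (1-2{t+s})π/L) + sin(x + (1-2{t-s})π/L)]/sin(π/L)`
(`{·}` the fractional part): the positive block is the run of integers `(⌈s-t⌉ ≤ a ≤ ⌊s+t⌋)` and its
cosine sum telescopes. [cite: CheungGefenRiedelShih1988] -/
theorem shiftedChannel_closedForms (hL : 2 ≤ L) {c : ℝ} (hc1 : -2 < c) (hc2 : c < 2) (θ : ℝ)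
    {x t s : ℝ} (hx : x = Real.arccos (-c / 2)) (ht : t = (L : ℝ) * x / (2 * Real.pi))
    (hs : s = θ / (2 * Real.pi)) :
    (((Finset.univ.filter fun a : ZMod L =>
        0 ≤ c + 2 * Real.cos ((2 * Real.pi * (a.val : ℝ) - θ) / L)).card : ℝ) =
        ⌊t + s⌋ + ⌊t - s⌋ + 1) ∧
    ∑ a : ZMod L, max (c + 2 * Real.cos ((2 * Real.pi * (a.val : ℝ) - θ) / L)) 0 =
      c * (⌊t + s⌋ + ⌊t - s⌋ + 1 : ℝ) +
        (Real.sin (x + (1 - 2 * Int.fract (t + s)) * Real.pi / L) +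
          Real.sin (x + (1 - 2 * Int.fract (t - s)) * Real.pi / L)) / Real.sin (Real.pi / L) := by
  -- basic facts
  have hL0 : (0 : ℝ) < L := by exact_mod_cast (show 0 < L by omega)
  have hL2 : (2 : ℝ) ≤ L := by exact_mod_cast hL
  have hπ := Real.pi_pos
  have hx0 : 0 < x := by rw [hx]; exact Real.arccos_pos.2 (by linarith)
  have hxπ : x < Real.pi := by rw [hx]; exact Real.arccos_lt_pi.2 (by linarith)
  have hcosx : Real.cos x = -c / 2 := by rw [hx]; exact Real.cos_arccos (by linarith) (by linarith)
  have hxt : 2 * Real.pi * t / L = x := by rw [ht]; field_simp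
  have h2t : 2 * t = L * x / Real.pi := by rw [ht]; field_simp
  have h2t_lt : 2 * t < L := by
    rw [h2t, div_lt_iff₀ hπ]; exact mul_lt_mul_of_pos_left hxπ hL0
  have h2t_pos : 0 < 2 * t := by rw [h2t]; positivity
  set up := Int.fract (t + s) with hup
  set um := Int.fract (t - s) with hum
  have hup0 : 0 ≤ up := Int.fract_nonneg _
  have hup1 : up < 1 := Int.fract_lt_one _
  have hum0 : 0 ≤ um := Int.fract_nonneg _
  have hum1 : um < 1 := Int.fract_lt_one _
  set n₀ : ℤ := ⌊t + s⌋ + ⌊t - s⌋ + 1 with hn₀def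
  have hn₀ : (n₀ : ℝ) = 2 * t + 1 - up - um := by
    have e1 := Int.fract_add_floor (t + s)
    have e2 := Int.fract_add_floor (t - s)
    rw [hn₀def]; push_cast; linarith
  have hn₀nn : 0 ≤ n₀ := by
    have : (-1 : ℝ) < n₀ := by rw [hn₀]; linarith
    exact_mod_cast (show (-1 : ℤ) < n₀ by exact_mod_cast this)
  have hn₀L : n₀ ≤ L := by
    have : (n₀ : ℝ) < L + 1 := by rw [hn₀]; linarith
    have : n₀ < (L : ℤ) + 1 := by exact_mod_cast this
    omega
  set N : ℕ := n₀.toNat with hNdef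
  have hNn₀ : (N : ℤ) = n₀ := Int.toNat_of_nonneg hn₀nn
  have hNL : N ≤ L := by omega
  have hNreal : (N : ℝ) = 2 * t + 1 - up - um := by
    rw [← hn₀]; exact_mod_cast hNn₀
  -- the window start and the angles
  set a₀ : ℤ := -⌊t - s⌋ with ha₀def
  have hangle : ∀ i : ℕ, (2 * Real.pi * (((a₀ + i : ℤ)) : ℝ) - θ) / L =
      2 * Real.pi * (um + i) / L - x := by
    intro i
    have e2 := Int.fract_add_floor (t - s)
    have hθ : θ = 2 * Real.pi * s := by rw [hs]; field_simp
    rw [ha₀def, hθ, ← hxt]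
    push_cast
    rw [show ((⌊t - s⌋ : ℤ) : ℝ) = t - s - um by linarith]
    field_simp
    ring
  -- sign pattern on the window
  have hin : ∀ i : ℕ, i < N → 0 ≤ c + 2 * Real.cos (2 * Real.pi * (um + i) / L - x) := by
    intro i hi
    have hi' : (i : ℝ) ≤ N - 1 := by
      have : i + 1 ≤ N := hi
      have : ((i : ℝ) + 1) ≤ N := by exact_mod_cast this
      linarith
    have hψ : 2 * Real.pi * (um + i) / L ≤ 2 * x := by
      rw [div_le_iff₀ hL0]
      have : um + i ≤ 2 * t := by rw [hNreal] at hi'; linarith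
      calc 2 * Real.pi * (um + i) ≤ 2 * Real.pi * (2 * t) := by nlinarith
        _ = 2 * x * L := by rw [h2t]; field_simp
    have := cos_le_cos_sub_of_window hxπ.le (by positivity) hψ
    linarith [hcosx]
  have hout : ∀ i : ℕ, N ≤ i → i < L → c + 2 * Real.cos (2 * Real.pi * (um + i) / L - x) < 0 := by
    intro i hi hiL
    have hi' : (N : ℝ) ≤ i := by exact_mod_cast hi
    have hiL' : (i : ℝ) + 1 ≤ L := by exact_mod_cast hiL
    have hψ : 2 * x < 2 * Real.pi * (um + i) / L := by
      rw [lt_div_iff₀ hL0]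
      have : 2 * t < um + i := by rw [hNreal] at hi'; linarith
      calc 2 * x * L = 2 * Real.pi * (2 * t) := by rw [h2t]; field_simp
        _ < 2 * Real.pi * (um + i) := by nlinarith
    have hψ2 : 2 * Real.pi * (um + i) / L < 2 * Real.pi := by
      rw [div_lt_iff₀ hL0]; nlinarith
    have := cos_sub_lt_cos_of_window hx0.le hψ hψ2
    linarith [hcosx]
  -- periodicity of the two integrand functions on ℤ
  have hper_cos : ∀ z : ℤ, Real.cos ((2 * Real.pi * (((z + L : ℤ)) : ℝ) - θ) / L) =
      Real.cos ((2 * Real.pi * ((z : ℤ) : ℝ) - θ) / L) := by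
    intro z
    push_cast
    rw [show (2 * Real.pi * ((z : ℝ) + L) - θ) / L = (2 * Real.pi * (z : ℝ) - θ) / L + 2 * Real.pi by
      field_simp; ring]
    exact Real.cos_add_two_pi _
  constructor
  · -- the count
    set g₁ : ℤ → ℝ := fun z => if 0 ≤ c + 2 * Real.cos ((2 * Real.pi * (z : ℝ) - θ) / L)
      then (1 : ℝ) else 0 with hg₁
    have hg₁p : Function.Periodic g₁ L := by
      intro z; simp only [hg₁]; rw [hper_cos]
    have hcard : ((Finset.univ.filter fun a : ZMod L =>
        0 ≤ c + 2 * Real.cos ((2 * Real.pi * (a.val : ℝ) - θ) / L)).card : ℝ) =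
        ∑ a : ZMod L, g₁ (a.val : ℤ) := by
      rw [Finset.card_filter]
      push_cast
      refine Finset.sum_congr rfl fun a _ => ?_
      simp only [hg₁, Int.cast_natCast]
    rw [hcard, sum_zmod_eq_sum_range_of_periodic hg₁p a₀]
    simp only [hg₁]
    rw [← Finset.sum_range_add_sum_Ico _ hNL]
    have h1 : ∑ i ∈ Finset.range N, (if 0 ≤ c + 2 * Real.cos ((2 * Real.pi * (((a₀ + (i : ℕ) : ℤ)) : ℝ) - θ) / L)
        then (1 : ℝ) else 0) = N := by
      rw [Finset.sum_congr rfl fun i hi => by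
        rw [hangle i, if_pos (hin i (Finset.mem_range.1 hi))], Finset.sum_const, Finset.card_range]
      simp
    have h2 : ∑ i ∈ Finset.Ico N L, (if 0 ≤ c + 2 * Real.cos ((2 * Real.pi * (((a₀ + (i : ℕ) : ℤ)) : ℝ) - θ) / L)
        then (1 : ℝ) else 0) = 0 := by
      refine Finset.sum_eq_zero fun i hi => ?_
      rw [Finset.mem_Ico] at hi
      rw [hangle i, if_neg (not_le.2 (hout i hi.1 hi.2))]
    rw [h1, h2, add_zero]
    have h := hNn₀
    rw [hn₀def] at h
    exact_mod_cast h
  · -- the sum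
    set g₂ : ℤ → ℝ := fun z => max (c + 2 * Real.cos ((2 * Real.pi * (z : ℝ) - θ) / L)) 0 with hg₂
    have hg₂p : Function.Periodic g₂ L := by
      intro z; simp only [hg₂]; rw [hper_cos]
    have hsum : ∑ a : ZMod L, max (c + 2 * Real.cos ((2 * Real.pi * (a.val : ℝ) - θ) / L)) 0 =
        ∑ a : ZMod L, g₂ (a.val : ℤ) := by
      refine Finset.sum_congr rfl fun a _ => ?_
      simp only [hg₂, Int.cast_natCast]
    rw [hsum, sum_zmod_eq_sum_range_of_periodic hg₂p a₀]
    simp only [hg₂]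
    rw [← Finset.sum_range_add_sum_Ico _ hNL]
    have h2 : ∑ i ∈ Finset.Ico N L, max (c + 2 * Real.cos ((2 * Real.pi * (((a₀ + (i : ℕ) : ℤ)) : ℝ) - θ) / L)) 0
        = 0 := by
      refine Finset.sum_eq_zero fun i hi => ?_
      rw [Finset.mem_Ico] at hi
      rw [hangle i]
      exact max_eq_right (hout i hi.1 hi.2).le
    have h1 : ∑ i ∈ Finset.range N, max (c + 2 * Real.cos ((2 * Real.pi * (((a₀ + (i : ℕ) : ℤ)) : ℝ) - θ) / L)) 0
        = c * N + 2 * ∑ i ∈ Finset.range N, Real.cos ((2 * Real.pi * um / L - x) + i * (2 * Real.pi / L)) := by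
      rw [Finset.sum_congr rfl fun i hi => by
        rw [hangle i, max_eq_left (hin i (Finset.mem_range.1 hi))], Finset.sum_add_distrib,
        Finset.sum_const, Finset.card_range, nsmul_eq_mul, Finset.mul_sum]
      congr 1
      · ring
      · refine Finset.sum_congr rfl fun i _ => ?_
        congr 1
        ring
    rw [h1, h2, add_zero]
    -- telescope
    have hsin : 0 < Real.sin (Real.pi / L) := sin_pi_div_pos hL
    have htel := two_sin_half_mul_sum_cos_arith (2 * Real.pi * um / L - x) (2 * Real.pi / L) N
    have e0 : 2 * Real.pi / L / 2 = Real.pi / L := by ring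
    rw [e0] at htel
    have e1 : 2 * Real.pi * um / L - x + ((N : ℝ) - 1 / 2) * (2 * Real.pi / L) =
        x + (1 - 2 * up) * Real.pi / L := by
      rw [hNreal]
      have h2x : (2 * t) * (2 * Real.pi / L) = 2 * x := by rw [h2t]; field_simp
      calc 2 * Real.pi * um / L - x + (2 * t + 1 - up - um - 1 / 2) * (2 * Real.pi / L)
          = 2 * Real.pi * um / L - x + (2 * t) * (2 * Real.pi / L)
              + (1 / 2 - up - um) * (2 * Real.pi / L) := by ring
        _ = 2 * Real.pi * um / L - x + 2 * x + (1 / 2 - up - um) * (2 * Real.pi / L) := by rw [h2x]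
        _ = x + (1 - 2 * up) * Real.pi / L := by ring
    have e2 : 2 * Real.pi * um / L - x - Real.pi / L = -(x + (1 - 2 * um) * Real.pi / L) := by ring
    rw [e1, e2, Real.sin_neg, sub_neg_eq_add] at htel
    have hfloor : ((⌊t + s⌋ : ℤ) : ℝ) + ((⌊t - s⌋ : ℤ) : ℝ) + 1 = 2 * t + 1 - up - um := by
      have := hn₀; rw [hn₀def] at this; push_cast at this; linarith
    have hS2 : 2 * ∑ i ∈ Finset.range N, Real.cos (2 * Real.pi * um / L - x + i * (2 * Real.pi / L)) =
        (Real.sin (x + (1 - 2 * up) * Real.pi / L) + Real.sin (x + (1 - 2 * um) * Real.pi / L)) /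
          Real.sin (Real.pi / L) := by
      rw [eq_div_iff hsin.ne']
      linear_combination htel
    rw [hS2, hNreal, hfloor]


/-- **Channel counting, lower bound for every offset**: `L·arccos(-c/2)/π - 1 ≤ #{a : c + 2cos((2πa-θ)/L) ≥ 0}`
for all real `c` (`arccos` clipped: full channels `c ≥ 2` count `L`, closed ones `c ≤ -2` count `≥ 0`).
[folklore] -/
theorem shiftedChannelCount_ge (hL : 2 ≤ L) (c θ : ℝ) :
    (L : ℝ) * Real.arccos (-c / 2) / Real.pi - 1 ≤
      ((Finset.univ.filter fun a : ZMod L =>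
        0 ≤ c + 2 * Real.cos ((2 * Real.pi * (a.val : ℝ) - θ) / L)).card : ℝ) := by
  have hπ := Real.pi_pos
  rcases le_or_gt 2 c with hc2 | hc2
  · rw [Real.arccos_of_le_neg_one (by linarith), Finset.filter_true_of_mem fun (a : ZMod L) _ => by
      linarith [Real.neg_one_le_cos ((2 * Real.pi * (a.val : ℝ) - θ) / L)], Finset.card_univ, ZMod.card]
    rw [mul_div_assoc, div_self hπ.ne', mul_one]
    linarith
  rcases le_or_gt c (-2) with hc1 | hc1
  · rw [Real.arccos_of_one_le (by linarith), mul_zero, zero_div]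
    linarith [Nat.cast_nonneg (α := ℝ) ((Finset.univ.filter fun a : ZMod L =>
        0 ≤ c + 2 * Real.cos ((2 * Real.pi * (a.val : ℝ) - θ) / L)).card)]
  obtain ⟨hcount, -⟩ := shiftedChannel_closedForms hL hc1 hc2 θ rfl rfl rfl
  rw [hcount]
  have e1 := Int.fract_add_floor ((L : ℝ) * Real.arccos (-c / 2) / (2 * Real.pi) + θ / (2 * Real.pi))
  have e2 := Int.fract_add_floor ((L : ℝ) * Real.arccos (-c / 2) / (2 * Real.pi) - θ / (2 * Real.pi))
  have f1 := Int.fract_lt_one ((L : ℝ) * Real.arccos (-c / 2) / (2 * Real.pi) + θ / (2 * Real.pi))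
  have f2 := Int.fract_lt_one ((L : ℝ) * Real.arccos (-c / 2) / (2 * Real.pi) - θ / (2 * Real.pi))
  have e3 : (L : ℝ) * Real.arccos (-c / 2) / Real.pi = 2 * ((L : ℝ) * Real.arccos (-c / 2) / (2 * Real.pi)) := by
    field_simp
  rw [e3]
  linarith

/-- **Channel counting, upper bound on an open channel**: `#{a : c + 2cos((2πa-θ)/L) ≥ 0} ≤ L·arccos(-c/2)/π + 1`
for `-2 < c < 2`. [folklore] -/
theorem shiftedChannelCount_le (hL : 2 ≤ L) {c : ℝ} (hc1 : -2 < c) (hc2 : c < 2) (θ : ℝ) :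
    ((Finset.univ.filter fun a : ZMod L =>
        0 ≤ c + 2 * Real.cos ((2 * Real.pi * (a.val : ℝ) - θ) / L)).card : ℝ) ≤
      (L : ℝ) * Real.arccos (-c / 2) / Real.pi + 1 := by
  have hπ := Real.pi_pos
  obtain ⟨hcount, -⟩ := shiftedChannel_closedForms hL hc1 hc2 θ rfl rfl rfl
  rw [hcount]
  have e1 := Int.fract_add_floor ((L : ℝ) * Real.arccos (-c / 2) / (2 * Real.pi) + θ / (2 * Real.pi))
  have e2 := Int.fract_add_floor ((L : ℝ) * Real.arccos (-c / 2) / (2 * Real.pi) - θ / (2 * Real.pi))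
  have f1 := Int.fract_nonneg ((L : ℝ) * Real.arccos (-c / 2) / (2 * Real.pi) + θ / (2 * Real.pi))
  have f2 := Int.fract_nonneg ((L : ℝ) * Real.arccos (-c / 2) / (2 * Real.pi) - θ / (2 * Real.pi))
  have e3 : (L : ℝ) * Real.arccos (-c / 2) / Real.pi = 2 * ((L : ℝ) * Real.arccos (-c / 2) / (2 * Real.pi)) := by
    field_simp
  rw [e3]
  linarith

/-- A full-period cosine sum over `ℤ/L` vanishes for every phase shift (`L ≥ 2`). [folklore] -/
theorem sum_zmod_cos_shift_eq_zero (hL : 2 ≤ L) (θ : ℝ) :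
    ∑ a : ZMod L, Real.cos ((2 * Real.pi * (a.val : ℝ) - θ) / L) = 0 := by
  have hL0 : (0 : ℝ) < L := by exact_mod_cast (show 0 < L by omega)
  set g : ℤ → ℝ := fun z => Real.cos ((2 * Real.pi * (z : ℝ) - θ) / L) with hg
  have hgp : Function.Periodic g L := by
    intro z; simp only [hg]
    push_cast
    rw [show (2 * Real.pi * ((z : ℝ) + L) - θ) / L = (2 * Real.pi * (z : ℝ) - θ) / L + 2 * Real.pi by
      field_simp; ring]
    exact Real.cos_add_two_pi _
  have h1 : ∑ a : ZMod L, Real.cos ((2 * Real.pi * (a.val : ℝ) - θ) / L) = ∑ a : ZMod L, g (a.val : ℤ) := by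
    refine Finset.sum_congr rfl fun a _ => ?_
    simp only [hg, Int.cast_natCast]
  rw [h1, sum_zmod_eq_sum_range_of_periodic hgp 0]
  simp only [hg, zero_add, Int.cast_natCast]
  have hsin : 0 < Real.sin (Real.pi / L) := sin_pi_div_pos hL
  have htel := two_sin_half_mul_sum_cos_arith (-θ / L) (2 * Real.pi / L) L
  have e0 : 2 * Real.pi / L / 2 = Real.pi / L := by ring
  have e1 : -θ / L + ((L : ℝ) - 1 / 2) * (2 * Real.pi / L) = (-θ / L - Real.pi / L) + 2 * Real.pi := by
    field_simp; ring
  rw [e0, e1, Real.sin_add_two_pi, sub_self] at htel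
  have h2 : ∑ i ∈ Finset.range L, Real.cos ((2 * Real.pi * (i : ℝ) - θ) / L) =
      ∑ i ∈ Finset.range L, Real.cos (-θ / L + i * (2 * Real.pi / L)) := by
    refine Finset.sum_congr rfl fun i _ => ?_
    congr 1; ring
  rw [h2]
  have h3 : (2 * Real.sin (Real.pi / L)) * ∑ i ∈ Finset.range L, Real.cos (-θ / L + i * (2 * Real.pi / L)) = 0 :=
    htel
  rcases mul_eq_zero.1 h3 with h | h
  · rcases mul_eq_zero.1 h with h' | h'
    · norm_num at h'
    · exact absurd h' hsin.ne'
  · exact h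

end Channel

end Summit.HubbardSuperconductivity.HubbardSuperconductivity.Theorems.WidthHaldane

end
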